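import Mathlib.LinearAlgebra.Matrix.ToLin
import Mathlib.LinearAlgebra.Matrix.Basis
import Mathlib.LinearAlgebra.Matrix.Invertible
import Mathlib.LinearAlgebra.Basis.VectorSpace
import Mathlib.LinearAlgebra.FiniteDimensional.Lemmas
import Literature.Barriers.Schanuel.AlgebraicIndependenceOfLogarithmsSixExpProofs
import HarnessLib

/-!
# Barrier (Schanuel): Roy's Theorem 4 and the deduction of Corollary 1 (Roy 1992, §4)

Second companion on the chain behind the named fact
`Literature.Barriers.Schanuel.roy1992_strongSixExponentials` (Roy 1992, §4 Corollary 2), continuing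
`Literature.Barriers.Schanuel.AlgebraicIndependenceOfLogarithmsSixExpProofs` (which defines Roy's
`θ̃(M)` = `thetaBar`, vendors Corollary 1 as `roy1992_cor1` and proves Corollary 2 from it).

## What the source prints [Roy1992]

* Notations (p. 24): `K = ℂ` (or `ℂ_p`); `ℚ̄ ⊂ K`; for each `d > 0` the `K`-space `K^d` carries the
  `ℚ̄`-structure `ℚ̄^d`, which "gives immediately the notions of a `K`-vector subspace of `K^d`
  which is rational over `ℚ̄` and of a `K`-linear mapping `f : K^{d₁} → K^{d₂}` which is rational
  over `ℚ̄`" (Bourbaki, Alg. II §8: `f` is rational over `ℚ̄` iff `f(ℚ̄^{d₁}) ⊆ ℚ̄^{d₂}`);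
  `𝓛̃ = ℚ̄ + ℚ̄·L`.
* §4, **Theorem 4** (p. 34): "Let `d` be a positive integer, `Z` be a finite dimensional
  `ℚ̄`-vector subspace of `𝓛̃^d`, and `U` be a `K`-vector subspace of `K^d` containing `Z`. Among
  the set of all surjective `K`-linear mappings `t : K^d → K^{d'}` which are rational over `ℚ̄` and
  non-zero, we choose one for which the ratio `dim_K(t(U))/d'` is minimal. Then, letting
  `Z' = t(Z)` and `U' = t(U)`, we have
  `dim_ℚ̄(Z')/(d' + dim_ℚ̄(Z')) ≤ dim_K(U')/d' ≤ dim_K(U)/d`. (1)"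
  (Proved there from Theorem 2, hence from Waldschmidt's Theorem 1, pp. 34–37.)
* §4, **Corollary 1** (p. 38) and its proof: "Let `φ : K^l → K^d` be the `K`-linear mapping given
  by `φ(x) = Mx` … We put `Z = φ(ℚ̄^l)` and `U = K·Z = φ(K^l)`. Then `d`, `Z`, and `U` fulfill the
  conditions of Theorem 4. Since `dim_K(U) = n`, this theorem asserts the existence of a surjective
  `K`-linear mapping `t : K^d → K^{d'}` which is rational over `ℚ̄`, and which, letting
  `l' = dim_ℚ̄(t(Z))`, satisfies `n ≥ l'd/(d' + l')`. (7) Since `t` is surjective and rational over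
  `ℚ̄`, there exists a basis `(u₁, …, u_d)` of `K^d` over `K`, made of elements of `ℚ̄^d`, whose
  `d − d'` last elements form a basis of `ker(t)` over `K`. Since `Z' = (t ∘ φ)(ℚ̄^l)` is of
  dimension `l'` over `ℚ̄`, there also exists a basis `(v₁, …, v_l)` of `K^l` over `K`, made of
  elements of `ℚ̄^l`, whose `l − l'` last elements belong to `ker(t ∘ φ)`. Relative to these bases
  of `K^d` and `K^l`, the matrix of `φ` can be written as a lower triangular block matrix
  `(M' 0; N N')`, with `M'` of size `d' × l'`. Since … the base-change matrices have their
  coefficients in `ℚ̄`, this implies `θ̃(M) ≤ l'/d'`. The announced inequality follows from this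
  upper bound combined with (7)."

## Lean rendering

* `IsRationalMap t` — a `ℂ`-linear `t : ℂ^{d₁} → ℂ^{d₂}` is rational over `ℚ̄` (`t(ℚ̄^{d₁}) ⊆ ℚ̄^{d₂}`,
  `ℚ̄ = algebraicClosure ℚ ℂ`).
* `roy1992_thm4` — Theorem 4 as a named fact, verbatim (for every minimising `t`; "non-zero" as
  `t ≠ 0`; `Z` a `ℚ̄`-submodule of `ℂ^d`, finite-dimensional, with entries in `𝓛̃ = logLinearForms`,
  `U` a `ℂ`-submodule with `Z ⊆ U`; `t(Z)` is the image under `t` restricted to `ℚ̄`-scalars).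
* `roy1992_cor1_of_thm4` — **Corollary 1 PROVED from Theorem 4** along the printed lines: a
  minimising `t` exists (the ratio takes finitely many values, `exists_minimal_rationalMap`);
  Theorem 4 gives (7); the bases adapted to `ker t` and `ker (t ∘ φ)` are packaged as invertible
  matrices over `ℚ̄` (`exists_isUnit_rows_eq`: an independent family is the top rows of an
  invertible matrix — used with the rows of the matrix of `t`, a variant of Roy's `(u_i)` giving
  the same block; `exists_isUnit_cols_mem`: a subspace of dimension `k` contains the last `k`
  columns of an invertible matrix — Roy's `(v_j)`), which yields the admissible couple `(d', l')`
  (`isBlockCouple_of_rationalMap`), so `θ̃(M) ≤ l'/d'`, and `x ↦ xd/(1+x)` is increasing.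
* `roy1992_strongSixExponentials_of_thm4` — the composite with the first companion:
  `roy1992_thm4 → roy1992_strongSixExponentials`.

What is NOT here: Theorems 1–2 and the proof of Theorem 4 from them (pp. 25–37).

## References

* [Roy1992] D. Roy, *Matrices whose coefficients are linear forms in logarithms*, J. Number
  Theory 41 (1992) 22–47: Notations p. 24; §4 Theorem 4 (p. 34); definition of `θ̃` (p. 37);
  Corollary 1 and its proof, Corollary 2 (p. 38).
-/

noncomputable section

open Complex Module

namespace Literature.Barriers.Schanuel

/-! ### Linear algebra: completing to invertible matrices -/

/-- **An independent family is the top of an invertible matrix**: `k` linearly independent vectors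
of `F^n` are the first `k` rows of an invertible `n × n` matrix (complete by a basis of a
complement of their span). [folklore] -/
theorem exists_isUnit_rows_eq {F : Type*} [Field F] {n k : ℕ} (w : Fin k → (Fin n → F))
    (hw : LinearIndependent F w) :
    ∃ B : Matrix (Fin n) (Fin n) F, IsUnit B ∧ ∀ (i : Fin n) (hi : (i : ℕ) < k), B i = w ⟨i, hi⟩ := by
  have hk : k ≤ n := by simpa using hw.fintype_card_le_finrank
  set R : Submodule F (Fin n → F) := Submodule.span F (Set.range w) with hRdef
  obtain ⟨C, hC⟩ := R.exists_isCompl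
  have hR : finrank F R = k := by
    rw [hRdef, finrank_span_eq_card hw, Fintype.card_fin]
  have hCn : finrank F C = n - k := by
    have h := Submodule.finrank_add_eq_of_isCompl hC
    rw [hR, finrank_fin_fun] at h
    omega
  let bR : Basis (Fin k) F R := Basis.span hw
  let bC : Basis (Fin (n - k)) F C := finBasisOfFinrankEq F C hCn
  let e : Fin k ⊕ Fin (n - k) ≃ Fin n := finSumFinEquiv.trans (finCongr (by omega))
  let b : Basis (Fin n) F (Fin n → F) :=
    ((bR.prod bC).map (Submodule.prodEquivOfIsCompl R C hC)).reindex e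
  refine ⟨Matrix.of fun i m => b i m, ?_, ?_⟩
  · have hT : (Pi.basisFun F (Fin n)).toMatrix b = (Matrix.of fun i m => b i m).transpose := by
      ext i m
      simp [Basis.toMatrix_apply, Pi.basisFun_repr]
    have hu : IsUnit ((Pi.basisFun F (Fin n)).toMatrix b) := by
      letI := (Pi.basisFun F (Fin n)).invertibleToMatrix b
      exact isUnit_of_invertible _
    rwa [hT, Matrix.isUnit_transpose] at hu
  · intro i hi
    have he : e.symm i = Sum.inl ⟨i, hi⟩ := by
      rw [Equiv.symm_apply_eq]
      ext
      simp [e]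
    funext m
    simp [b, Basis.reindex_apply, he, bR]
    exact congrFun (Basis.coe_span_apply hw ⟨i, hi⟩) m

/-- **A subspace contains the tail of an invertible matrix**: a subspace `W ⊆ F^n` of dimension
`k` contains the last `k` columns (indices `j ≥ n − k`) of an invertible `n × n` matrix.
[folklore] -/
theorem exists_isUnit_cols_mem {F : Type*} [Field F] {n k : ℕ} (W : Submodule F (Fin n → F))
    (hW : finrank F W = k) :
    ∃ B : Matrix (Fin n) (Fin n) F, IsUnit B ∧ ∀ j : Fin n, n - k ≤ (j : ℕ) → (fun i => B i j) ∈ W := by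
  let bW : Basis (Fin k) F W := finBasisOfFinrankEq F W hW
  have hli : LinearIndependent F (fun x => (bW x : Fin n → F)) :=
    bW.linearIndependent.map' W.subtype W.ker_subtype
  obtain ⟨B₀, hB₀, hrows⟩ := exists_isUnit_rows_eq _ hli
  refine ⟨(B₀.submatrix Fin.revPerm (Equiv.refl _)).transpose, ?_, ?_⟩
  · rw [Matrix.isUnit_transpose, Matrix.isUnit_submatrix_equiv]
    exact hB₀
  · intro j hj
    have hrev : ((Fin.rev j : Fin n) : ℕ) < k := by
      rw [Fin.val_rev]
      omega
    have : (fun i => (B₀.submatrix Fin.revPerm (Equiv.refl _)).transpose i j) = B₀ (Fin.rev j) := by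
      funext i
      simp
    rw [this, hrows _ hrev]
    exact Submodule.coe_mem _

/-! ### Rationality over `ℚ̄` -/

/-- A `ℂ`-linear map `t : ℂ^{d₁} → ℂ^{d₂}` is **rational over `ℚ̄`** if `t(ℚ̄^{d₁}) ⊆ ℚ̄^{d₂}`
(Bourbaki's notion for the `ℚ̄`-structures `ℚ̄^{dᵢ} ⊂ K^{dᵢ}`; `ℚ̄ = algebraicClosure ℚ ℂ`).
[cite: Roy1992, Notations (p. 24)] -/
def IsRationalMap {d₁ d₂ : ℕ} (t : (Fin d₁ → ℂ) →ₗ[ℂ] (Fin d₂ → ℂ)) : Prop :=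
  ∀ v : Fin d₁ → ℂ, (∀ i, v i ∈ algebraicClosure ℚ ℂ) → ∀ j, t v j ∈ algebraicClosure ℚ ℂ

/-- The identity map is rational over `ℚ̄`. [folklore] -/
theorem isRationalMap_id (d : ℕ) : IsRationalMap (LinearMap.id : (Fin d → ℂ) →ₗ[ℂ] (Fin d → ℂ)) :=
  fun _ hv j => hv j

/-- The matrix of a map rational over `ℚ̄` has entries in `ℚ̄`. [folklore] -/
theorem toMatrix'_mem_of_isRationalMap {d₁ d₂ : ℕ} {t : (Fin d₁ → ℂ) →ₗ[ℂ] (Fin d₂ → ℂ)}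
    (ht : IsRationalMap t) (i : Fin d₂) (j : Fin d₁) :
    LinearMap.toMatrix' t i j ∈ algebraicClosure ℚ ℂ := by
  rw [LinearMap.toMatrix'_apply]
  refine ht _ (fun k => ?_) i
  by_cases h : k = j
  · subst h; simp
  · simp [h]

/-- The `ℚ̄`-linear inclusion `ℚ̄^n → ℂ^n`. [folklore] -/
def qbarVec (n : ℕ) : (Fin n → algebraicClosure ℚ ℂ) →ₗ[algebraicClosure ℚ ℂ] (Fin n → ℂ) where
  toFun c := fun i => (c i : ℂ)
  map_add' x y := by funext i; simp
  map_smul' a x := by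
    funext i
    simp [IntermediateField.smul_def, smul_eq_mul]

/-- `qbarVec` is the coordinatewise coercion. [folklore] -/
@[simp] theorem qbarVec_apply {n : ℕ} (c : Fin n → algebraicClosure ℚ ℂ) (i : Fin n) :
    qbarVec n c i = (c i : ℂ) := rfl

/-! ### Theorem 4 (named fact) -/

/-- **Roy 1992, §4 Theorem 4 (the main result).** "Let `d` be a positive integer, `Z` be a
finite dimensional `ℚ̄`-vector subspace of `𝓛̃^d`, and `U` be a `K`-vector subspace of `K^d`
containing `Z`. Among the set of all surjective `K`-linear mappings `t : K^d → K^{d'}` which are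
rational over `ℚ̄` and non-zero, we choose one for which the ratio `dim_K(t(U))/d'` is minimal.
Then, letting `Z' = t(Z)` and `U' = t(U)`, we have
`dim_ℚ̄(Z')/(d' + dim_ℚ̄(Z')) ≤ dim_K(U')/d' ≤ dim_K(U)/d`." Here `K = ℂ`,
`ℚ̄ = algebraicClosure ℚ ℂ`, `𝓛̃ = logLinearForms`, "rational over `ℚ̄`" = `IsRationalMap`, and the
conclusion is asserted for every minimising `t` (as printed). Proved in print from Theorem 2,
itself from Waldschmidt's Theorem 1 (= [Waldschmidt1988, Thm 4.1] for `G_a^{d₀} × G_m^{d₁}`);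
named fact, users take `(h : roy1992_thm4)`. [cite: Roy1992, §4 Theorem 4 (p. 34)] -/
def roy1992_thm4 : Prop :=
  ∀ (d : ℕ), 0 < d →
  ∀ (Z : Submodule (algebraicClosure ℚ ℂ) (Fin d → ℂ)) (U : Submodule ℂ (Fin d → ℂ)),
    Module.Finite (algebraicClosure ℚ ℂ) Z →
    (∀ z ∈ Z, ∀ i, z i ∈ logLinearForms) →
    Z ≤ U.restrictScalars (algebraicClosure ℚ ℂ) →
  ∀ (d' : ℕ) (t : (Fin d → ℂ) →ₗ[ℂ] (Fin d' → ℂ)),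
    Function.Surjective t → IsRationalMap t → t ≠ 0 →
    (∀ (d'' : ℕ) (t' : (Fin d → ℂ) →ₗ[ℂ] (Fin d'' → ℂ)),
        Function.Surjective t' → IsRationalMap t' → t' ≠ 0 →
        (finrank ℂ (U.map t) : ℝ) / d' ≤ (finrank ℂ (U.map t') : ℝ) / d'') →
    (finrank (algebraicClosure ℚ ℂ) (Z.map (t.restrictScalars (algebraicClosure ℚ ℂ))) : ℝ) /
        (d' + finrank (algebraicClosure ℚ ℂ) (Z.map (t.restrictScalars (algebraicClosure ℚ ℂ)))) ≤
      (finrank ℂ (U.map t) : ℝ) / d' ∧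
    (finrank ℂ (U.map t) : ℝ) / d' ≤ (finrank ℂ U : ℝ) / d

/-! ### A minimising rational surjection exists -/

/-- Among the surjective, non-zero `ℂ`-linear maps `ℂ^d → ℂ^{d'}` rational over `ℚ̄` (`d > 0`),
some `t` minimises `dim(t(U))/d'` (the ratio takes finitely many values: `d' ≤ d`,
`dim t(U) ≤ d`). [folklore] -/
theorem exists_minimal_rationalMap {d : ℕ} (hd : 0 < d) (U : Submodule ℂ (Fin d → ℂ)) :
    ∃ (d' : ℕ) (t : (Fin d → ℂ) →ₗ[ℂ] (Fin d' → ℂ)), Function.Surjective t ∧ IsRationalMap t ∧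
      t ≠ 0 ∧ ∀ (d'' : ℕ) (t' : (Fin d → ℂ) →ₗ[ℂ] (Fin d'' → ℂ)),
        Function.Surjective t' → IsRationalMap t' → t' ≠ 0 →
        (finrank ℂ (U.map t) : ℝ) / d' ≤ (finrank ℂ (U.map t') : ℝ) / d'' := by
  set S : Set ℝ := {x | ∃ (d' : ℕ) (t : (Fin d → ℂ) →ₗ[ℂ] (Fin d' → ℂ)), Function.Surjective t ∧
    IsRationalMap t ∧ t ≠ 0 ∧ x = (finrank ℂ (U.map t) : ℝ) / d'} with hS
  have hne : S.Nonempty := by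
    refine ⟨_, d, LinearMap.id, Function.surjective_id, isRationalMap_id d, ?_, rfl⟩
    haveI : Nontrivial (Fin d → ℂ) := by
      refine ⟨⟨0, fun _ => 1, ?_⟩⟩
      intro h
      have := congrFun h ⟨0, hd⟩
      simp at this
    exact one_ne_zero
  have hfin : S.Finite := by
    refine Set.Finite.subset ((Finset.finite_toSet (Finset.range (d + 1) ×ˢ Finset.range (d + 1))).image
      fun p : ℕ × ℕ => (p.1 : ℝ) / (p.2 : ℝ)) ?_
    rintro x ⟨d', t, ht, -, -, rfl⟩
    refine ⟨(finrank ℂ (U.map t), d'), ?_, rfl⟩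
    have hd' : d' ≤ d := by
      have := LinearMap.finrank_le_finrank_of_surjective ht
      simpa using this
    have hU : finrank ℂ (U.map t) ≤ d := by
      have h1 : finrank ℂ (U.map t) ≤ finrank ℂ (Fin d' → ℂ) := Submodule.finrank_le _
      rw [finrank_fin_fun] at h1
      omega
    simp only [Finset.coe_product, Finset.coe_range, Set.mem_prod, Set.mem_Iio]
    omega
  obtain ⟨d', t, ht, hrat, hne0, heq⟩ := hne.csInf_mem hfin
  refine ⟨d', t, ht, hrat, hne0, fun d'' t' ht' hrat' hne' => ?_⟩
  rw [← heq]
  exact csInf_le hfin.bddBelow ⟨d'', t', ht', hrat', hne', rfl⟩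

/-! ### The block form furnished by a rational surjection (proof of Corollary 1) -/

section Block

variable {d l : ℕ}

/-- The `ℚ̄`-span `Z = φ(ℚ̄^l)` of the columns of `M` (`φ(x) = Mx`). [cite: Roy1992, §4 proof of Corollary 1 (p. 38)] -/
def colSpanQbar (M : Matrix (Fin d) (Fin l) ℂ) : Submodule (algebraicClosure ℚ ℂ) (Fin d → ℂ) :=
  Submodule.span (algebraicClosure ℚ ℂ) (Set.range M.col)

/-- The `ℂ`-span `U = K·Z = φ(K^l)` of the columns of `M`. [cite: Roy1992, §4 proof of Corollary 1 (p. 38)] -/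
def colSpan (M : Matrix (Fin d) (Fin l) ℂ) : Submodule ℂ (Fin d → ℂ) :=
  Submodule.span ℂ (Set.range M.col)

/-- `dim_K U = rank M`. [folklore] -/
theorem finrank_colSpan (M : Matrix (Fin d) (Fin l) ℂ) : finrank ℂ (colSpan M) = M.rank :=
  (Matrix.rank_eq_finrank_span_cols M).symm

/-- `Z` is finite-dimensional over `ℚ̄`. [folklore] -/
instance colSpanQbar_finite (M : Matrix (Fin d) (Fin l) ℂ) :
    Module.Finite (algebraicClosure ℚ ℂ) (colSpanQbar M) :=
  Module.Finite.span_of_finite _ (Set.finite_range _)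

/-- `Z ⊆ U`. [folklore] -/
theorem colSpanQbar_le (M : Matrix (Fin d) (Fin l) ℂ) :
    colSpanQbar M ≤ (colSpan M).restrictScalars (algebraicClosure ℚ ℂ) :=
  Submodule.span_le_restrictScalars _ _ _

/-- If the entries of `M` lie in `𝓛̃` then `Z ⊆ 𝓛̃^d`. [cite: Roy1992, §4 proof of Corollary 1 (p. 38)] -/
theorem mem_logLinearForms_of_mem_colSpanQbar {M : Matrix (Fin d) (Fin l) ℂ}
    (hM : ∀ i j, M i j ∈ logLinearForms) {z : Fin d → ℂ} (hz : z ∈ colSpanQbar M) (i : Fin d) :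
    z i ∈ logLinearForms := by
  have hle : colSpanQbar M ≤ Submodule.pi Set.univ (fun _ : Fin d => logLinearForms) := by
    refine Submodule.span_le.2 ?_
    rintro _ ⟨j, rfl⟩
    exact fun i _ => hM i j
  exact hle hz i (Set.mem_univ i)

/-- `t(Z)` is the `ℚ̄`-span of the vectors `t(M.col j)`; in particular `dim_ℚ̄ t(Z) ≤ l`. [folklore] -/
theorem map_colSpanQbar_eq {d' : ℕ} (M : Matrix (Fin d) (Fin l) ℂ)
    (t : (Fin d → ℂ) →ₗ[ℂ] (Fin d' → ℂ)) :
    (colSpanQbar M).map (t.restrictScalars (algebraicClosure ℚ ℂ)) =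
      Submodule.span (algebraicClosure ℚ ℂ) (Set.range fun j => t (M.col j)) := by
  rw [colSpanQbar, Submodule.map_span, ← Set.range_comp]
  rfl

/-- **The admissible couple furnished by a rational surjection** (the base-change step in the
proof of Corollary 1): if `t : ℂ^d → ℂ^{d'}` (`d' > 0`) is surjective and rational over `ℚ̄`, and
`l' = dim_ℚ̄ t(Z)` where `Z` is the `ℚ̄`-span of the columns of `M`, then `(d', l')` is admissible
for `θ̃(M)`: with `P ∈ GL_d(ℚ̄)` whose first `d'` rows are the rows of the matrix of `t`, and
`Q ∈ GL_l(ℚ̄)` whose last `l − l'` columns lie in the kernel of `x ↦ t(Mx)` on `ℚ̄^l`, the entries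
of `PMQ` in rows `< d'` and columns `≥ l'` are coordinates of `t(MQ eⱼ) = 0`.
[cite: Roy1992, §4 proof of Corollary 1 (p. 38)] -/
theorem isBlockCouple_of_rationalMap (M : Matrix (Fin d) (Fin l) ℂ) {d' : ℕ} (hd' : 0 < d')
    (t : (Fin d → ℂ) →ₗ[ℂ] (Fin d' → ℂ)) (ht : Function.Surjective t) (hrat : IsRationalMap t) :
    IsBlockCouple M d'
      (finrank (algebraicClosure ℚ ℂ)
        ((colSpanQbar M).map (t.restrictScalars (algebraicClosure ℚ ℂ)))) := by
  set Qb := algebraicClosure ℚ ℂ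
  set l' := finrank Qb ((colSpanQbar M).map (t.restrictScalars Qb)) with hl'def
  -- the matrix of `t`, with entries in `ℚ̄`
  set T : Matrix (Fin d') (Fin d) ℂ := LinearMap.toMatrix' t with hTdef
  let T₀ : Matrix (Fin d') (Fin d) Qb := fun i k => ⟨T i k, toMatrix'_mem_of_isRationalMap hrat i k⟩
  have hT₀ : ∀ i k, (T₀ i k : ℂ) = T i k := fun i k => rfl
  -- `d' ≤ d` and the rows of `T` are independent (rank `T = d'`)
  have hd'd : d' ≤ d := by
    simpa using LinearMap.finrank_le_finrank_of_surjective ht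
  have hrankT : T.rank = d' := by
    have h1 : T.rank = finrank ℂ (LinearMap.range t) := by
      rw [Matrix.rank, hTdef, ← Matrix.toLin'_apply', Matrix.toLin'_toMatrix']
    rw [h1, LinearMap.range_eq_top.2 ht, finrank_top, finrank_fin_fun]
  have hrowsC : LinearIndependent ℂ T.row := by
    rw [linearIndependent_iff_card_eq_finrank_span, Fintype.card_fin, Set.finrank,
      ← Matrix.rank_eq_finrank_span_row, hrankT]
  have hrowsQ : LinearIndependent Qb (fun i => T₀ i) := by
    have h1 : LinearIndependent Qb T.row :=
      hrowsC.restrict_scalars (by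
        intro a b hab
        simpa [IntermediateField.smul_def] using hab)
    have hcomp : (⇑(qbarVec d) ∘ fun i => T₀ i) = T.row := by
      funext i k
      rfl
    exact LinearIndependent.of_comp (qbarVec d) (hcomp ▸ h1)
  obtain ⟨P, hP, hProws⟩ := exists_isUnit_rows_eq _ hrowsQ
  -- the kernel of `c ↦ ∑ c_j t(M.col j)` on `ℚ̄^l` has dimension `l - l'`
  let ψ : (Fin l → Qb) →ₗ[Qb] (Fin d' → ℂ) := Fintype.linearCombination Qb fun j => t (M.col j)
  have hψrange : finrank Qb (LinearMap.range ψ) = l' := by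
    rw [hl'def, map_colSpanQbar_eq, Fintype.range_linearCombination]
  have hker : finrank Qb (LinearMap.ker ψ) = l - l' := by
    have h := LinearMap.finrank_range_add_finrank_ker ψ
    rw [hψrange, finrank_fin_fun] at h
    omega
  obtain ⟨Q, hQ, hQcols⟩ := exists_isUnit_cols_mem _ hker
  have hl'l : l' ≤ l := by
    rw [hl'def, map_colSpanQbar_eq]
    have h := finrank_range_le_card (R := Qb) fun j => t (M.col j)
    rw [Fintype.card_fin] at h
    exact h
  refine ⟨hd', hd'd, hl'l, P, Q, hP, hQ, ?_⟩
  intro i j hi hj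
  -- column `j` of `M Q'` is killed by `t`
  set Q' : Matrix (Fin l) (Fin l) ℂ := Q.map (algebraMap Qb ℂ) with hQ'
  have hcolker : t ((M * Q').col j) = 0 := by
    have hmem : (fun k => Q k j) ∈ LinearMap.ker ψ := hQcols j (by omega)
    rw [LinearMap.mem_ker, Fintype.linearCombination_apply] at hmem
    have hcol : (M * Q').col j = ∑ k, Q k j • M.col k := by
      funext m
      simp [hQ', Matrix.col_apply, Matrix.mul_apply, Finset.sum_apply, Pi.smul_apply,
        IntermediateField.smul_def, smul_eq_mul, mul_comm]
    rw [hcol, map_sum]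
    simpa using hmem
  -- entry `(i, j)` of `P' (M Q')` is the `i`-th coordinate of `t` of that column
  have hPi : ∀ m, (P.map (algebraMap Qb ℂ)) i m = T ⟨i, hi⟩ m := by
    intro m
    rw [Matrix.map_apply, hProws i hi]
    rfl
  calc (P.map (algebraMap Qb ℂ) * M * Q') i j
      = ∑ m, T ⟨i, hi⟩ m * (M * Q') m j := by
        rw [Matrix.mul_assoc, Matrix.mul_apply]
        exact Finset.sum_congr rfl fun m _ => by rw [hPi]
    _ = (T.mulVec ((M * Q').col j)) ⟨i, hi⟩ := by
        simp [Matrix.mulVec, dotProduct, Matrix.col_apply]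
    _ = t ((M * Q').col j) ⟨i, hi⟩ := by rw [hTdef, LinearMap.toMatrix'_mulVec]
    _ = 0 := by rw [hcolker]; rfl

end Block

/-! ### Corollary 1 from Theorem 4, and the strong six exponentials theorem from Theorem 4 -/

/-- `x ↦ x·d/(1 + x)` is monotone on `x ≥ 0`. [folklore] -/
theorem mul_div_one_add_mono {x y d : ℝ} (hx : 0 ≤ x) (hxy : x ≤ y) (hd : 0 ≤ d) :
    x * d / (1 + x) ≤ y * d / (1 + y) := by
  have hy : 0 ≤ y := hx.trans hxy
  rw [div_le_div_iff₀ (by positivity) (by positivity)]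
  nlinarith [mul_nonneg hd hx, mul_nonneg hd hy]

/-- **Roy 1992, Corollary 1 PROVED from Theorem 4** (`roy1992_thm4 → roy1992_cor1`), following
the printed proof: with `Z = φ(ℚ̄^l)`, `U = φ(K^l)` (`dim_K U = rank M = n`) and a minimising
rational surjection `t` (`exists_minimal_rationalMap`), Theorem 4 gives
`l'/(d' + l') ≤ dim U'/d' ≤ n/d`, i.e. `n ≥ l'd/(d' + l')` (7); the base change
(`isBlockCouple_of_rationalMap`) gives `θ̃(M) ≤ l'/d'`, and `x ↦ xd/(1+x)` is increasing.
[cite: Roy1992, §4 Corollary 1 and its proof (p. 38)] -/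
theorem roy1992_cor1_of_thm4 (h4 : roy1992_thm4) : roy1992_cor1 := by
  intro d l M hd hl hM
  set Qb := algebraicClosure ℚ ℂ
  obtain ⟨d', t, ht, hrat, hne, hmin⟩ := exists_minimal_rationalMap hd (colSpan M)
  have hd'0 : 0 < d' := by
    rcases Nat.eq_zero_or_pos d' with h0 | h0
    · subst h0
      exact absurd (LinearMap.ext fun v => Subsingleton.elim _ _) hne
    · exact h0
  obtain ⟨h1, h2⟩ := h4 d hd (colSpanQbar M) (colSpan M) (colSpanQbar_finite M)
    (fun z hz i => mem_logLinearForms_of_mem_colSpanQbar hM hz i) (colSpanQbar_le M)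
    d' t ht hrat hne hmin
  set l' := finrank Qb ((colSpanQbar M).map (t.restrictScalars Qb)) with hl'
  set a := finrank ℂ ((colSpan M).map t) with ha
  rw [finrank_colSpan] at h2
  have hblock : IsBlockCouple M d' l' := isBlockCouple_of_rationalMap M hd'0 t ht hrat
  have hθ : thetaBar M ≤ (l' : ℝ) / (d' : ℝ) := thetaBar_le_div hblock
  have hθ0 : 0 ≤ thetaBar M := thetaBar_nonneg M hd
  have hdR : (0 : ℝ) < d := by exact_mod_cast hd
  have hd'R : (0 : ℝ) < d' := by exact_mod_cast hd'0
  -- `θ̃ d/(1+θ̃) ≤ (l'/d') d / (1 + l'/d') = l' d/(d' + l') ≤ n`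
  calc thetaBar M * d / (1 + thetaBar M)
      ≤ (l' : ℝ) / d' * d / (1 + (l' : ℝ) / d') := mul_div_one_add_mono hθ0 hθ hdR.le
    _ = (l' : ℝ) / (d' + l') * d := by
        field_simp
    _ ≤ (a : ℝ) / d' * d := by
        exact mul_le_mul_of_nonneg_right h1 hdR.le
    _ ≤ (M.rank : ℝ) / d * d := by
        exact mul_le_mul_of_nonneg_right h2 hdR.le
    _ = M.rank := by field_simp

/-- **The strong six exponentials theorem from Roy's Theorem 4** (PROVED reduction
`roy1992_thm4 → roy1992_strongSixExponentials`, composing `roy1992_cor1_of_thm4` with the first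
companion's `roy1992_strongSixExponentials_of_cor1`); what remains un-discharged below it is
Theorem 4, i.e. Roy's Theorem 2 and Waldschmidt's Theorem 1. [cite: Roy1992, §4 Corollary 2 (p. 38)] -/
theorem roy1992_strongSixExponentials_of_thm4 (h4 : roy1992_thm4) :
    roy1992_strongSixExponentials :=
  roy1992_strongSixExponentials_of_cor1 (roy1992_cor1_of_thm4 h4)

end Literature.Barriers.Schanuel
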